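import Literature.Analysis.Asymptotics.MonomialTailAsymptotics
import Literature.Analysis.Asymptotics.LaplacePowerLogAbelian
import Mathlib.Analysis.SpecialFunctions.Integrals.Basic
import HarnessLib

/-!
# Power-log asymptotics of sublevel volumes and Laplace integrals of a monomial (cube form)

The elementary case of the asymptotic theory of Laplace integrals with real-analytic phase
(Arnold–Gusein-Zade–Varchenko II §7.2, Thm. 7.1 / Thm. 7.3 for a phase `+x_1^{k_1}⋯x_n^{k_n}`
with a monomial weight; Lin 2017, Prop. 2.1), transported from the logarithmic coordinates of
`MonomialTailAsymptotics.lean` to the unit cube: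

* `measurePreserving_exp_neg` : `y ↦ e^{-y}` carries `e^{-ωy}dy` on `(0,∞)` to `x^{ω-1}dx` on
  `(0,1]` (`powMeasure ω`), hence (`measure_sublevel_eq`) the `∏ x_j^{w_j-1}dx_j`-volume of
  `{x ∈ (0,1]^d : ∏ x_j^{κ_j} ≤ t}` is `tailProfile κ w (log 1/t)`;
* `tendsto_sublevelVolume` : that volume is `∼ C t^λ (log 1/t)^{θ-1}` as `t → 0⁺`, `C > 0`,
  `λ = rlct κ w = min_{κ_j ≠ 0} w_j/κ_j`, `θ = rlctMult κ w`;
* `tendsto_laplaceIntegral` : `∫_{(0,1]^d} e^{-β x^κ} ∏ x_j^{w_j-1} dx_j · β^λ/(log β)^{θ-1} → C Γ(λ+1)`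
  as `β → ∞` (by the Abelian theorem of `LaplacePowerLogAbelian.lean`).

Everything is PROVED; one definition (`powMeasure`), no named facts.

## References

* V. I. Arnold, S. M. Gusein-Zade, A. N. Varchenko, *Singularities of Differentiable Maps II*
  (2012), Part II §7.2, Thm. 7.1, Thm. 7.3 (4). [ArnoldGuseinzadeVarchenko2012]
* S. Lin, arXiv:1003.5338, Prop. 2.1 and Thm. 2.9 (monomial case). [Lin2017]
-/

noncomputable section

open MeasureTheory Filter Set Topology

open scoped ENNReal

namespace Literature.Analysis.Asymptotics.MonomialPhase

/-! ## The weight `x^{ω-1} dx` on `(0,1]` and the logarithmic change of variables -/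

/-- The finite measure `x^{ω-1} dx` on `(0,1]` (the weight of Lin 2017, Prop. 2.1 with
`ω = τ + 1`; of AGV II §7.2 with `ω = m + 1`). [folklore] -/
def powMeasure (ω : ℝ) : Measure ℝ :=
  (volume.restrict (Ioc (0 : ℝ) 1)).withDensity fun x => ENNReal.ofReal (x ^ (ω - 1))

/-- Unfolding lemma for `powMeasure`. [folklore] -/
theorem powMeasure_def (ω : ℝ) : powMeasure ω =
    (volume.restrict (Ioc (0 : ℝ) 1)).withDensity fun x => ENNReal.ofReal (x ^ (ω - 1)) :=
  rfl

/-- `powMeasure ω s = ∫_{s ∩ (0,1]} x^{ω-1} dx`. [folklore] -/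
theorem powMeasure_apply (ω : ℝ) {s : Set ℝ} (hs : MeasurableSet s) :
    powMeasure ω s = ∫⁻ x in s ∩ Ioc 0 1, ENNReal.ofReal (x ^ (ω - 1)) := by
  rw [powMeasure, withDensity_apply _ hs, Measure.restrict_restrict hs]

/-- `powMeasure ω` lives on `(0,1]`. [folklore] -/
theorem powMeasure_restrict_Ioc (ω : ℝ) : (powMeasure ω).restrict (Ioc 0 1) = powMeasure ω := by
  rw [powMeasure, restrict_withDensity measurableSet_Ioc, Measure.restrict_restrict measurableSet_Ioc,
    inter_self]

/-- `powMeasure ω (-∞, a] = (min a 1)^ω / ω` for `0 < a`, `0 < ω`. [folklore] -/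
theorem powMeasure_Iic {ω : ℝ} (hω : 0 < ω) {a : ℝ} (ha : 0 < a) :
    powMeasure ω (Iic a) = ENNReal.ofReal ((min a 1) ^ ω / ω) := by
  have hm : 0 < min a 1 := lt_min ha one_pos
  have hset : Iic a ∩ Ioc (0 : ℝ) 1 = Ioc 0 (min a 1) := by
    ext x
    simp only [mem_inter_iff, mem_Iic, mem_Ioc, le_min_iff]
    tauto
  have hint : IntegrableOn (fun x : ℝ => x ^ (ω - 1)) (Ioc 0 (min a 1)) := by
    have h := (intervalIntegral.intervalIntegrable_rpow' (a := 0) (b := min a 1)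
      (by linarith : (-1 : ℝ) < ω - 1))
    rw [intervalIntegrable_iff, uIoc_of_le hm.le] at h
    exact h
  rw [powMeasure_apply ω measurableSet_Iic, hset,
    ← ofReal_integral_eq_lintegral_ofReal hint
      ((ae_restrict_iff' measurableSet_Ioc).2 (ae_of_all _ fun x hx =>
        Real.rpow_nonneg hx.1.le _)),
    ← intervalIntegral.integral_of_le hm.le, integral_rpow (Or.inl (by linarith)),
    Real.zero_rpow (by linarith), sub_zero, sub_add_cancel]

/-- `expMeasure ω [c, ∞) = e^{-ω max(c,0)} / ω` for `0 < ω`. [folklore] -/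
theorem expMeasure_Ici {ω : ℝ} (hω : 0 < ω) (c : ℝ) :
    expMeasure ω (Ici c) = ENNReal.ofReal (Real.exp (-(ω * max c 0)) / ω) := by
  have hset : volume.restrict (Ici c ∩ Ioi (0 : ℝ)) = volume.restrict (Ioi (max c 0)) := by
    refine Measure.restrict_congr_set ?_
    rcases le_or_gt c 0 with hc | hc
    · rw [max_eq_right hc, (inter_eq_right (s := Ici c) (t := Ioi 0)).2 fun x hx =>
        mem_Ici.2 (hc.trans (le_of_lt hx))]
    · rw [max_eq_left hc.le, (inter_eq_left (s := Ici c) (t := Ioi 0)).2 fun x hx =>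
        mem_Ioi.2 (hc.trans_le hx)]
      exact Ioi_ae_eq_Ici.symm
  have hint : IntegrableOn (fun y : ℝ => Real.exp (-(ω * y))) (Ioi (max c 0)) :=
    (integrableOn_exp_neg hω).mono_set (Ioi_subset_Ioi (le_max_right _ _))
  rw [expMeasure_apply ω measurableSet_Ici, hset,
    ← ofReal_integral_eq_lintegral_ofReal hint (ae_of_all _ fun y => (Real.exp_pos _).le)]
  congr 1
  have h := integral_exp_mul_Ioi (neg_neg_iff_pos.2 hω) (max c 0)
  rw [show (fun y : ℝ => Real.exp (-(ω * y))) = fun y => Real.exp (-ω * y) from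
    funext fun y => by rw [neg_mul], h, neg_mul, neg_div_neg_eq]

/-- **The logarithmic change of variables** `x = e^{-y}` carries `e^{-ωy} dy` on `(0,∞)` to
`x^{ω-1} dx` on `(0,1]`. [folklore] -/
theorem measurePreserving_exp_neg {ω : ℝ} (hω : 0 < ω) :
    MeasurePreserving (fun y : ℝ => Real.exp (-y)) (expMeasure ω) (powMeasure ω) := by
  haveI := isFiniteMeasure_expMeasure hω
  have hf : Measurable fun y : ℝ => Real.exp (-y) := by fun_prop
  refine ⟨hf, Measure.ext_of_Iic _ _ fun a => ?_⟩
  rw [Measure.map_apply hf measurableSet_Iic]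
  rcases le_or_gt a 0 with ha | ha
  · -- both sides vanish
    have h1 : (fun y : ℝ => Real.exp (-y)) ⁻¹' Iic a = ∅ :=
      eq_empty_of_forall_notMem fun y (hy : Real.exp (-y) ≤ a) => (Real.exp_pos _).not_ge
        (hy.trans ha)
    have h2 : powMeasure ω (Iic a) = 0 := by
      rw [powMeasure_apply ω measurableSet_Iic]
      have : Iic a ∩ Ioc (0 : ℝ) 1 = ∅ :=
        eq_empty_of_forall_notMem fun x hx => (hx.2.1.trans_le (hx.1.trans ha)).false
      rw [this, Measure.restrict_empty, lintegral_zero_measure]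
    rw [h1, measure_empty, h2]
  · have h1 : (fun y : ℝ => Real.exp (-y)) ⁻¹' Iic a = Ici (-Real.log a) := by
      ext y
      simp only [mem_preimage, mem_Iic, mem_Ici]
      rw [← Real.le_log_iff_exp_le ha]
      constructor <;> intro h <;> linarith
    rw [h1, expMeasure_Ici hω, powMeasure_Iic hω ha]
    congr 2
    rcases le_or_gt 1 a with ha1 | ha1
    · rw [min_eq_right ha1, Real.one_rpow, max_eq_right (by
        rw [neg_nonpos]; exact Real.log_nonneg ha1), mul_zero, neg_zero, Real.exp_zero]
    · rw [min_eq_left ha1.le, max_eq_left (by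
        rw [le_neg, neg_zero]; exact (Real.log_neg ha ha1).le),
        Real.rpow_def_of_pos ha]
      congr 1
      ring

/-- `powMeasure ω` is a finite measure for `ω > 0`. [folklore] -/
theorem isFiniteMeasure_powMeasure {ω : ℝ} (hω : 0 < ω) : IsFiniteMeasure (powMeasure ω) := by
  haveI := isFiniteMeasure_expMeasure hω
  rw [← (measurePreserving_exp_neg hω).map_eq]
  infer_instance

variable {d : ℕ}

/-- The factors of the cube weight are σ-finite. [folklore] -/
theorem sigmaFinite_powMeasure {w : Fin d → ℝ} (hw : ∀ j, 0 < w j) :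
    ∀ j, SigmaFinite (powMeasure (w j)) := fun j =>
  @IsFiniteMeasure.toSigmaFinite _ _ _ (isFiniteMeasure_powMeasure (hw j))

/-- The cube weight `∏_j x_j^{w_j-1} dx_j` is a finite measure. [folklore] -/
theorem isFiniteMeasure_pi_powMeasure {w : Fin d → ℝ} (hw : ∀ j, 0 < w j) :
    IsFiniteMeasure (Measure.pi fun j => powMeasure (w j)) := by
  haveI := sigmaFinite_powMeasure hw
  haveI : ∀ j, IsFiniteMeasure (powMeasure (w j)) := fun j => isFiniteMeasure_powMeasure (hw j)
  infer_instance

/-- The cube weight lives on the cube `(0,1]^d`. [folklore] -/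
theorem pi_powMeasure_apply_eq_inter {w : Fin d → ℝ} (hw : ∀ j, 0 < w j) (A : Set (Fin d → ℝ))
    (hA : MeasurableSet A) :
    (Measure.pi fun j => powMeasure (w j)) A =
      (Measure.pi fun j => powMeasure (w j)) (A ∩ Set.pi univ fun _ => Ioc (0 : ℝ) 1) := by
  haveI := sigmaFinite_powMeasure hw
  have h : (Measure.pi fun j => powMeasure (w j)) =
      (Measure.pi fun j => powMeasure (w j)).restrict (Set.pi univ fun _ => Ioc (0 : ℝ) 1) := by
    rw [Measure.restrict_pi_pi]
    simp_rw [powMeasure_restrict_Ioc]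
  conv_lhs => rw [h, Measure.restrict_apply hA]

/-- The product change of variables `x_j = e^{-y_j}`. [folklore] -/
theorem measurePreserving_pi_exp_neg {w : Fin d → ℝ} (hw : ∀ j, 0 < w j) :
    MeasurePreserving (fun (y : Fin d → ℝ) (j : Fin d) => Real.exp (-y j))
      (Measure.pi fun j => expMeasure (w j)) (Measure.pi fun j => powMeasure (w j)) := by
  haveI := sigmaFinite_powMeasure hw
  exact measurePreserving_pi _ _ fun j => measurePreserving_exp_neg (hw j)

/-- The sublevel set of the monomial is measurable. [folklore] -/
theorem measurableSet_sublevel (κ : Fin d → ℕ) (t : ℝ) :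
    MeasurableSet {x : Fin d → ℝ | ∏ j, x j ^ κ j ≤ t} :=
  measurableSet_le (by fun_prop) measurable_const

/-- **Sublevel volume = tail profile**: for `t > 0`,
`vol_w {x ∈ (0,1]^d : ∏ x_j^{κ_j} ≤ t} = tailProfile κ w (log 1/t)`. [folklore] -/
theorem measure_sublevel_eq (κ : Fin d → ℕ) {w : Fin d → ℝ} (hw : ∀ j, 0 < w j) {t : ℝ}
    (ht : 0 < t) :
    ((Measure.pi fun j => powMeasure (w j)) {x : Fin d → ℝ | ∏ j, x j ^ κ j ≤ t}).toReal =
      tailProfile κ w (Real.log t⁻¹) := by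
  rw [tailProfile_def, ← (measurePreserving_pi_exp_neg hw).measure_preimage
    (measurableSet_sublevel κ t).nullMeasurableSet]
  congr 2
  ext y
  simp only [mem_preimage, mem_setOf_eq]
  have hprod : ∏ j, Real.exp (-y j) ^ κ j = Real.exp (-∑ j, (κ j : ℝ) * y j) := by
    rw [← Finset.sum_neg_distrib, Real.exp_sum]
    refine Finset.prod_congr rfl fun j _ => ?_
    rw [← Real.exp_nat_mul]
    congr 1
    ring
  rw [hprod, Real.log_inv, ← Real.le_log_iff_exp_le ht]
  constructor <;> intro h <;> linarith

/-! ## The asymptotics in the cube -/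

/-- **Power-log asymptotics of the weighted sublevel volume of a monomial** (Arnold–Gusein-Zade–
Varchenko II §7.2 Thm. 7.1, leading term for the phase `+x^κ`; Lin 2017 Prop. 2.1): for `κ ≠ 0`
and weights `w_j > 0` there is `C > 0` with
`vol_w {x ∈ (0,1]^d : ∏ x_j^{κ_j} ≤ t} / (t^λ (log 1/t)^{θ-1}) → C` as `t → 0⁺`, where
`vol_w = ∏_j x_j^{w_j-1} dx_j`, `λ = rlct κ w = min_{κ_j ≠ 0} w_j/κ_j` and `θ = rlctMult κ w`.
[cite: ArnoldGuseinzadeVarchenko2012, Part II §7.2 Thm. 7.1] [cite: Lin2017, Prop. 2.1] -/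
theorem tendsto_sublevelVolume (κ : Fin d → ℕ) {w : Fin d → ℝ} (hw : ∀ j, 0 < w j)
    (hκ : κ ≠ 0) :
    ∃ C : ℝ, 0 < C ∧ Tendsto (fun t : ℝ =>
      ((Measure.pi fun j => powMeasure (w j)) {x : Fin d → ℝ | ∏ j, x j ^ κ j ≤ t}).toReal /
        (t ^ rlct κ w * Real.log t⁻¹ ^ (rlctMult κ w - 1))) (𝓝[>] 0) (𝓝 C) := by
  obtain ⟨C, hC, h⟩ := tendsto_tailProfile d κ w hw hκ
  refine ⟨C, hC, ?_⟩
  have hlog : Tendsto (fun t : ℝ => Real.log t⁻¹) (𝓝[>] 0) atTop :=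
    Real.tendsto_log_atTop.comp tendsto_inv_nhdsGT_zero
  refine (h.comp hlog).congr' ?_
  filter_upwards [self_mem_nhdsWithin] with t (ht : 0 < t)
  simp only [Function.comp_apply]
  rw [measure_sublevel_eq κ hw ht, Real.log_inv, mul_neg, Real.exp_neg, ← Real.log_rpow ht,
    Real.exp_log (Real.rpow_pos_of_pos ht _)]
  field_simp

/-- **Power-log asymptotics of the Laplace integral of a monomial phase** (AGV II §7.2,
Thm. 7.3 (4) leading term; Lin 2017, Prop. 2.1 with Thm. 2.9): for `κ ≠ 0` and weights `w_j > 0`,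
`(∫_{(0,1]^d} e^{-β ∏|x_j|^{κ_j}} ∏ x_j^{w_j-1} dx_j) · β^λ / (log β)^{θ-1} → C Γ(λ+1)` as `β → ∞`,
with the constant `C > 0` of `tendsto_sublevelVolume`, `λ = rlct κ w`, `θ = rlctMult κ w`.
[cite: ArnoldGuseinzadeVarchenko2012, Part II §7.2 Thm. 7.3] [cite: Lin2017, Prop. 2.1] -/
theorem tendsto_laplaceIntegral (κ : Fin d → ℕ) {w : Fin d → ℝ} (hw : ∀ j, 0 < w j)
    (hκ : κ ≠ 0) :
    ∃ C : ℝ, 0 < C ∧ Tendsto (fun β : ℝ =>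
      (∫ x, Real.exp (-(β * ∏ j, |x j| ^ κ j)) ∂(Measure.pi fun j => powMeasure (w j))) *
        β ^ rlct κ w / Real.log β ^ (rlctMult κ w - 1)) atTop
      (𝓝 (C * Real.Gamma (rlct κ w + 1))) := by
  obtain ⟨C, hC, hV⟩ := tendsto_sublevelVolume κ hw hκ
  haveI := isFiniteMeasure_pi_powMeasure hw
  refine ⟨C, hC, ?_⟩
  have hS : Measurable fun x : Fin d → ℝ => ∏ j, |x j| ^ κ j := by fun_prop
  have hS0 : ∀ x : Fin d → ℝ, 0 ≤ ∏ j, |x j| ^ κ j :=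
    fun x => Finset.prod_nonneg fun j _ => pow_nonneg (abs_nonneg _) _
  refine LaplacePowerLog.tendsto_laplace_mul_rpow_div_log_pow hS hS0 (rlct_pos hκ hw).le ?_
  refine hV.congr' (Eventually.of_forall fun t => ?_)
  congr 2
  rw [pi_powMeasure_apply_eq_inter hw _ (measurableSet_le hS measurable_const),
    pi_powMeasure_apply_eq_inter hw _ (measurableSet_sublevel κ t)]
  congr 1
  ext x
  simp only [mem_inter_iff, mem_setOf_eq]
  refine and_congr_left fun hx => ?_
  rw [Set.mem_univ_pi] at hx
  have h : ∏ j, |x j| ^ κ j = ∏ j, x j ^ κ j :=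
    Finset.prod_congr rfl fun j _ => by rw [abs_of_pos (hx j).1]
  rw [h]

end Literature.Analysis.Asymptotics.MonomialPhase

end
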